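import Literature.MathematicalPhysics.QuantumFieldTheory.Balaban1983to89.B15Ineq157Flow
import Literature.MathematicalPhysics.QuantumFieldTheory.Balaban1983to89.B15Claim184
import Literature.MathematicalPhysics.QuantumFieldTheory.Balaban1983to89.B15PrelimIntegrations

/-!
# `Balaban1983to89.B15GammaSmallness` — [Balaban1989LargeFieldI] §1: the *"for γ sufficiently small"* clauses —
# p. 186 *"The numerical factor 8B₃L^{−i}δ′_j < 8B₃γA₁p₁(γ) can be also chosen arbitrarily small for γ sufficiently
# small"*, and the EXPLICIT γ-discharges of the located smallness hypotheses carried by the B15 proof files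

statement-level skeleton of published theorems with citation tags; proofs where landed; nothing here is a claim about
the Yang–Mills mass gap.

CITATION HEADER (lean-in-tree rule 2026-08-18).  T. Bałaban, *Large field renormalization. I. The basic step of the 𝐑
operation*, Commun. Math. Phys. **122**, 175–202 (1989), doi:10.1007/BF01257412, bib `Balaban1989LargeFieldI` (cell
paper B15; PDF held `paper:balaban1989-cmp122-large-field-i`, journal page = PDF page + 174; pp. 183–186, 198 = PDF 9–12,
24).  "[III]" = [Balaban1988Convergent] CMP **119**, (2.4)–(2.5) p. 255 (tree: `Setup.epsK`, `B14.IsRj`), the standing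
interval hypothesis `0 < g_k ≤ γ` (`Setup.Flow.InInterval`).  WHAT IS REPRODUCED: the γ-smallness sentences attached to
SKELETON rows `B15.Eq1.46` (p. 186), `B15.Eq1.31` (p. 184 input *"B₃exp(−δ2M₂R_j)22d²ε_j < (β/10)ε_j"*), `B15.Eq1.39` /
`B15.Eq1.42` (p. 185 *"We assume that it [γ] is so small that the expression on the left-hand side of (1.37) can be
bounded by ½δ_j"*, (1.42) *"≦ ½δ_j"*), `B15.Eq1.90` (p. 198 *"11d²B₃exp(−R_h)ε_h < αε_h"*), `B15.Note@184` (p. 184 *"From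
the restrictions (1.27) we get the bound O(1)δ′_j < ε_j"*); unit `lit-balaban-r12` gen 8 (reader/typer and fold owner of
block B15), HOME `run/shared/lean/pub/lit-balaban/` (`lit-balaban-r12/ROWS-B15.md`).  Used BY NAME, nothing restated:
`B15.Ineq194Flow.deltaPrimeK`/`logPow` (δ′_j = g_jA₁(log g_j⁻²)^{p₁}), `Setup.p0Profile`/`epsK`, `B14.IsRj` ((2.5)),
`B15Ineq157Flow.exp_neg_R_le_of_isRj`, `B14FlowStep.log_inv_sq_mono`/`log_inv_sq_nonneg`, the typed leaf
`B15.PrelimIntegrations.Ineq142`, `B15Ineq157Flow.boundH190_lt_alpha`, `B15Claim184.smallness184`.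

THE PRINTED TEXT.  p. 183 l. 1: *"δ′_j = g_jA₁p₁(g_j), p₁(g_j) = (log g_j⁻²)^{p₁}, and p₁ < p₀"*; p. 184: *"From the
restrictions (1.27) we get the bound O(1)δ′_j < ε_j, hence the functions (1.5) are equal to 1 also"*, and the input of
(1.31) *"B₃exp(−δ2M₂R_j)22d²ε_j < (β/10)ε_j"*; p. 185: *"We assume that it is so small that the expression on the
left-hand side of (1.37) can be bounded by ½δ_j"*, (1.38) *"… = B₃(4p₁(g_j)/p₀(g_j) + exp(−δMR_{j+1})44d²(1+β₀)A₀/A₁)δ_j"*,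
(1.42) *"< O(1)B₃exp(−δLM₂R_{j+1})22d²(1+β₀)(A₀/A₁)δ_j ≦ ½δ_j"*; p. 186: *"The numerical factor 8B₃L^{−i}δ′_j < 8B₃γA₁p₁(γ)
can be also chosen arbitrarily small for γ sufficiently small."*; p. 198: *"B₃exp(−δ2LM₂R_h)11d²ε_h < 11d²B₃exp(−R_h)ε_h
< αε_h, where α is a small, absolute constant"*; [III] (2.5) p. 255: *"R_j is the smallest number of the form L^r such,
that R_j ≥ (log g_j⁻²)^r"*.

WHAT IS PROVED (0 `sorry`, no `def`, no new `Prop`).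
* §1 the coupling profile `g ↦ g(log g⁻²)^p`: `mul_logPow_mono` (MONOTONE on `0 < x ≤ y` as soon as `log y⁻² ≥ 2p`, i.e.
  `y ≤ e^{−p}` — the content of print's *"δ′_j < γA₁p₁(γ)"* for `g_j ≤ γ`), `mul_logPow_le_sqrt` (EXPLICIT:
  `g(log g⁻²)^p ≤ (4p)^p√g` on `(0, 1]`, from `log x ≤ x^ε/ε` — the content of *"arbitrarily small for γ sufficiently small"*).
* §2 along a flow with `0 < g_k ≤ γ` (`InInterval`): `deltaPrimeK_le_gamma_profile` (**p. 186 AS PRINTED**: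
  `δ′_j ≤ γA₁p₁(γ)` for `γ ≤ e^{−p₁}`), `deltaPrimeK_le_sqrt` (`δ′_j ≤ A₁(4p₁)^{p₁}√γ`), `const_mul_deltaPrimeK_le`
  (`K·δ′_j ≤ τ` once `K·A₁(4p₁)^{p₁}√γ ≤ τ`) and its instance `smallness146_of_gamma` (p29's located `128B₃δ′_j ≤ 1` of
  `B15Ineq146Proof.ineq146_of_145`).
* §3 the radii: `exp_neg_R_le_gamma_sq` (`e^{−R_j} ≤ γ²` from (2.5) with `r ≥ 1`, for `log γ⁻² ≥ 1`, i.e. `γ ≤ e^{−1/2}`),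
  `exp_neg_mul_R_le_gamma_sq` (`e^{−cR_j} ≤ γ²`, `c ≥ 1`).
* §4 the discharges: `ineq131_input_of_gamma` ((1.31) input, `δ2M₂ ≥ 1`, `B₃22d²γ² < β/10`), `ineq142_second_of_gamma` /
  `ineq142_of_gamma` ((1.42) last member `≦ ½δ_j` and the leaf `Ineq142`, `δLM₂ ≥ 1`, `O(1)B₃22d²(1+β₀)(A₀/A₁)γ² ≤ ½`),
  `boundH190_lt_alpha_of_gamma` ((1.90) chain with its α-clause from `11d²B₃γ² < α`), `logPow_ratio_le` /
  `ineq137_half_of_gamma` (p. 185: `p₁(g_j)/p₀(g_j) ≤ (log γ⁻²)⁻¹` for `p₁ < p₀`, whence `c·B₃(4p₁/p₀ + e^{−δMR}44d²(1+β₀)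
  A₀/A₁) ≤ ½` from an explicit γ-clause), `smallness184_of_gamma` (Note@184: `C·A₁ < A₀(log g_j⁻²)^{p₀−p₁}` from
  `C·A₁ < A₀ log γ⁻²`).
HONEST SCOPE.  Elementary real analysis making print's *"γ sufficiently small"* explicit (every clause becomes an
inequality in `γ`, `√γ`, `γ²` or `(log γ⁻²)⁻¹` with the printed constants); which `γ` the series finally fixes is [III]'s
business (`B14FlowStep.SmallnessFor` collects the flow clauses).  NOT summit progress.
-/

namespace Literature.MathematicalPhysics.QuantumFieldTheory.Balaban1983to89.B15GammaSmallness

open Literature.MathematicalPhysics.QuantumFieldTheory.Balaban1983to89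
open B15.Ineq194Flow B15Ineq157Flow B15Claim184 B15.PrelimIntegrations B14FlowStep B15StandardRep

/-! ## §1. The coupling profile `g ↦ g(log g⁻²)^p` -/

/-- `log (g²)⁻¹ = −2 log g`. [folklore] -/
private theorem log_inv_sq_eq (g : ℝ) : Real.log (g ^ 2)⁻¹ = -2 * Real.log g := by
  rw [Real.log_inv, Real.log_pow]
  push_cast
  ring

/-- `g = exp(−½·log (g²)⁻¹)` for `g > 0`. [folklore] -/
private theorem eq_exp_neg_half_log {g : ℝ} (hg : 0 < g) : g = Real.exp (-(Real.log (g ^ 2)⁻¹ / 2)) := by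
  rw [log_inv_sq_eq g]
  have : -(-2 * Real.log g / 2) = Real.log g := by ring
  rw [this, Real.exp_log hg]

/-- **MONOTONICITY OF THE PROFILE** (the content of p. 186 *"8B₃L^{−i}δ′_j < 8B₃γA₁p₁(γ)"* for `g_j ≤ γ`): for
`0 < x ≤ y` with `log y⁻² ≥ 2p` (i.e. `y ≤ e^{−p}`), `x(log x⁻²)^p ≤ y(log y⁻²)^p`.  Proof: with `u = log x⁻² ≥ v =
log y⁻² ≥ 2p`, `(u/v)^p ≤ e^{p(u/v − 1)} ≤ e^{(u−v)/2}`. [cite: Balaban1989LargeFieldI, p.186] -/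
theorem mul_logPow_mono {x y : ℝ} (hx : 0 < x) (hxy : x ≤ y) {p : ℕ} (hyp : 2 * (p : ℝ) ≤ Real.log (y ^ 2)⁻¹) :
    x * logPow p x ≤ y * logPow p y := by
  have hy : 0 < y := hx.trans_le hxy
  unfold logPow
  set u := Real.log (x ^ 2)⁻¹ with hu
  set v := Real.log (y ^ 2)⁻¹ with hv
  have huv : v ≤ u := log_inv_sq_mono hx hxy
  have hv0 : 0 ≤ v := le_trans (by positivity) hyp
  have hxe : x = Real.exp (-(u / 2)) := eq_exp_neg_half_log hx
  have hye : y = Real.exp (-(v / 2)) := eq_exp_neg_half_log hy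
  rcases Nat.eq_zero_or_pos p with hp | hp
  · subst hp
    simp only [pow_zero, mul_one]
    exact hxy
  · -- `v > 0` since `v ≥ 2p ≥ 2`
    have hp1 : (1 : ℝ) ≤ p := by exact_mod_cast hp
    have hvpos : 0 < v := by linarith
    -- `u^p ≤ v^p · e^{(u−v)/2}`
    have hratio : (u / v) ^ p ≤ Real.exp ((u - v) / 2) := by
      have h1 : u / v ≤ Real.exp (u / v - 1) := by
        have := Real.add_one_le_exp (u / v - 1)
        linarith
      have h0 : 0 ≤ u / v := div_nonneg (hv0.trans huv) hv0
      have h2 : (u / v) ^ p ≤ (Real.exp (u / v - 1)) ^ p := pow_le_pow_left₀ h0 h1 p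
      have h3 : (Real.exp (u / v - 1)) ^ p = Real.exp (p * (u / v - 1)) := by
        rw [← Real.exp_nat_mul]
      have h4 : (p : ℝ) * (u / v - 1) ≤ (u - v) / 2 := by
        have e1 : (p : ℝ) * (u / v - 1) = (p / v) * (u - v) := by
          field_simp
        have hpv : (p : ℝ) / v ≤ 1 / 2 := by
          rw [div_le_iff₀ hvpos]
          linarith
        rw [e1]
        have huv' : 0 ≤ u - v := by linarith
        calc (p : ℝ) / v * (u - v) ≤ 1 / 2 * (u - v) := mul_le_mul_of_nonneg_right hpv huv'
          _ = (u - v) / 2 := by ring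
      calc (u / v) ^ p ≤ (Real.exp (u / v - 1)) ^ p := h2
        _ = Real.exp (p * (u / v - 1)) := h3
        _ ≤ Real.exp ((u - v) / 2) := Real.exp_le_exp.mpr h4
    have hup : u ^ p ≤ v ^ p * Real.exp ((u - v) / 2) := by
      have e1 : u ^ p = v ^ p * (u / v) ^ p := by
        rw [div_pow, mul_div_cancel₀]
        exact pow_ne_zero _ hvpos.ne'
      rw [e1]
      exact mul_le_mul_of_nonneg_left hratio (pow_nonneg hv0 p)
    rw [hxe, hye]
    have hexp : Real.exp (-(u / 2)) * (v ^ p * Real.exp ((u - v) / 2)) = Real.exp (-(v / 2)) * v ^ p := by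
      have : Real.exp (-(u / 2)) * Real.exp ((u - v) / 2) = Real.exp (-(v / 2)) := by
        rw [← Real.exp_add]
        congr 1
        ring
      calc Real.exp (-(u / 2)) * (v ^ p * Real.exp ((u - v) / 2))
          = (Real.exp (-(u / 2)) * Real.exp ((u - v) / 2)) * v ^ p := by ring
        _ = Real.exp (-(v / 2)) * v ^ p := by rw [this]
    calc Real.exp (-(u / 2)) * u ^ p ≤ Real.exp (-(u / 2)) * (v ^ p * Real.exp ((u - v) / 2)) :=
          mul_le_mul_of_nonneg_left hup (Real.exp_pos _).le
      _ = Real.exp (-(v / 2)) * v ^ p := hexp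

/-- **EXPLICIT BOUND OF THE PROFILE** (the content of *"arbitrarily small for γ sufficiently small"*): for `0 < g ≤ 1`
and `p ≥ 1`, `g(log g⁻²)^p ≤ (4p)^p√g` (from `log x ≤ x^ε/ε` at `x = g⁻¹`, `ε = 1/(2p)`). [cite: Balaban1989LargeFieldI, p.186] -/
theorem mul_logPow_le_sqrt {g : ℝ} (hg : 0 < g) (hg1 : g ≤ 1) {p : ℕ} (hp : 1 ≤ p) :
    g * logPow p g ≤ (4 * (p : ℝ)) ^ p * Real.sqrt g := by
  have hp0 : (0 : ℝ) < p := by exact_mod_cast hp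
  have hε : (0 : ℝ) < 1 / (2 * p) := by positivity
  have h1 : Real.log g⁻¹ ≤ (g⁻¹) ^ (1 / (2 * (p : ℝ))) / (1 / (2 * p)) :=
    Real.log_le_rpow_div (inv_nonneg.mpr hg.le) hε
  have h2 : Real.log (g ^ 2)⁻¹ ≤ 4 * p * (g⁻¹) ^ (1 / (2 * (p : ℝ))) := by
    rw [log_inv_sq_eq g]
    have e1 : (g⁻¹) ^ (1 / (2 * (p : ℝ))) / (1 / (2 * p)) = 2 * p * (g⁻¹) ^ (1 / (2 * (p : ℝ))) := by
      field_simp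
    rw [e1, Real.log_inv] at h1
    linarith
  have h0 : 0 ≤ Real.log (g ^ 2)⁻¹ := log_inv_sq_nonneg hg hg1
  have h3 : logPow p g ≤ (4 * p * (g⁻¹) ^ (1 / (2 * (p : ℝ)))) ^ p := pow_le_pow_left₀ h0 h2 p
  have h4 : ((g⁻¹) ^ (1 / (2 * (p : ℝ)))) ^ p = (Real.sqrt g)⁻¹ := by
    rw [← Real.rpow_natCast, ← Real.rpow_mul (inv_nonneg.mpr hg.le)]
    have e1 : 1 / (2 * (p : ℝ)) * p = 1 / 2 := by field_simp
    rw [e1, Real.inv_rpow hg.le, Real.sqrt_eq_rpow]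
  have h5 : g * logPow p g ≤ g * ((4 * (p : ℝ)) ^ p * (Real.sqrt g)⁻¹) := by
    have := mul_le_mul_of_nonneg_left h3 hg.le
    rwa [mul_pow, h4] at this
  have hs : 0 < Real.sqrt g := Real.sqrt_pos.mpr hg
  have h6 : g * (Real.sqrt g)⁻¹ = Real.sqrt g := by
    rw [mul_inv_eq_iff_eq_mul₀ hs.ne', Real.mul_self_sqrt hg.le]
  calc g * logPow p g ≤ g * ((4 * (p : ℝ)) ^ p * (Real.sqrt g)⁻¹) := h5
    _ = (4 * (p : ℝ)) ^ p * (g * (Real.sqrt g)⁻¹) := by ring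
    _ = (4 * (p : ℝ)) ^ p * Real.sqrt g := by rw [h6]

/-! ## §2. `δ′_j` along a flow in the interval `(0, γ]` -/

section Flow

variable {F : Flow} {γ : ℝ} {K : ℕ}

/-- **p. 186 AS PRINTED**: *"8B₃L^{−i}δ′_j < 8B₃γA₁p₁(γ)"* — along a flow with `0 < g_k ≤ γ` (`k ≤ K`) and
`γ ≤ e^{−p₁}` (`log γ⁻² ≥ 2p₁`), `δ′_j = g_jA₁p₁(g_j) ≤ γA₁p₁(γ)` for `j ≤ K` (`A₁ ≥ 0`; print's strict `<` is carried by
the extra factor `L^{−i} < 1`, `i ≥ 1`). [cite: Balaban1989LargeFieldI, p.186] -/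
theorem deltaPrimeK_le_gamma_profile {A₁ : ℝ} (hA₁ : 0 ≤ A₁) {p₁ : ℕ} (hI : F.InInterval γ K)
    (hγp : 2 * (p₁ : ℝ) ≤ Real.log (γ ^ 2)⁻¹) {j : ℕ} (hj : j ≤ K) :
    deltaPrimeK A₁ p₁ F j ≤ γ * p0Profile A₁ p₁ γ := by
  obtain ⟨hg, hgγ⟩ := hI j hj
  rw [deltaPrimeK, p0Profile_eq_mul_logPow, p0Profile_eq_mul_logPow]
  have h := mul_logPow_mono hg hgγ hγp
  calc F.g j * (A₁ * logPow p₁ (F.g j)) = A₁ * (F.g j * logPow p₁ (F.g j)) := by ring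
    _ ≤ A₁ * (γ * logPow p₁ γ) := mul_le_mul_of_nonneg_left h hA₁
    _ = γ * (A₁ * logPow p₁ γ) := by ring

/-- **`δ′_j ≤ A₁(4p₁)^{p₁}√γ`** along a flow with `0 < g_k ≤ γ ≤ 1` (`p₁ ≥ 1`, `A₁ ≥ 0`) — the explicit form of
*"arbitrarily small for γ sufficiently small"*. [cite: Balaban1989LargeFieldI, p.186] -/
theorem deltaPrimeK_le_sqrt {A₁ : ℝ} (hA₁ : 0 ≤ A₁) {p₁ : ℕ} (hp₁ : 1 ≤ p₁) (hI : F.InInterval γ K) (hγ1 : γ ≤ 1)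
    {j : ℕ} (hj : j ≤ K) : deltaPrimeK A₁ p₁ F j ≤ A₁ * (4 * (p₁ : ℝ)) ^ p₁ * Real.sqrt γ := by
  obtain ⟨hg, hgγ⟩ := hI j hj
  rw [deltaPrimeK, p0Profile_eq_mul_logPow]
  have h := mul_logPow_le_sqrt hg (hgγ.trans hγ1) hp₁
  have hsqrt : Real.sqrt (F.g j) ≤ Real.sqrt γ := Real.sqrt_le_sqrt hgγ
  calc F.g j * (A₁ * logPow p₁ (F.g j)) = A₁ * (F.g j * logPow p₁ (F.g j)) := by ring
    _ ≤ A₁ * ((4 * (p₁ : ℝ)) ^ p₁ * Real.sqrt (F.g j)) := mul_le_mul_of_nonneg_left h hA₁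
    _ ≤ A₁ * ((4 * (p₁ : ℝ)) ^ p₁ * Real.sqrt γ) :=
        mul_le_mul_of_nonneg_left (mul_le_mul_of_nonneg_left hsqrt (by positivity)) hA₁
    _ = A₁ * (4 * (p₁ : ℝ)) ^ p₁ * Real.sqrt γ := by ring

/-- `K·δ′_j ≤ τ` as soon as `K·A₁(4p₁)^{p₁}√γ ≤ τ` (`K ≥ 0`): every "numerical factor × δ′_j can be chosen arbitrarily
small" clause, explicitly. [cite: Balaban1989LargeFieldI, p.186] -/
theorem const_mul_deltaPrimeK_le {A₁ Kc τ : ℝ} (hKc : 0 ≤ Kc) (hA₁ : 0 ≤ A₁) {p₁ : ℕ} (hp₁ : 1 ≤ p₁)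
    (hI : F.InInterval γ K) (hγ1 : γ ≤ 1) {j : ℕ} (hj : j ≤ K)
    (hτ : Kc * (A₁ * (4 * (p₁ : ℝ)) ^ p₁ * Real.sqrt γ) ≤ τ) : Kc * deltaPrimeK A₁ p₁ F j ≤ τ :=
  (mul_le_mul_of_nonneg_left (deltaPrimeK_le_sqrt hA₁ hp₁ hI hγ1 hj) hKc).trans hτ

/-- The located smallness of `B15Ineq146Proof.ineq146_of_145` (p29: `128B₃δ′_j ≤ 1`, print p. 186 *"8B₃L^{−i}δ′_j …
arbitrarily small"*) from an explicit γ-clause: `128B₃A₁(4p₁)^{p₁}√γ ≤ 1`. [cite: Balaban1989LargeFieldI, (1.46) p.186] -/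
theorem smallness146_of_gamma {A₁ B₃ : ℝ} (hB₃ : 0 ≤ B₃) (hA₁ : 0 ≤ A₁) {p₁ : ℕ} (hp₁ : 1 ≤ p₁)
    (hI : F.InInterval γ K) (hγ1 : γ ≤ 1) {j : ℕ} (hj : j ≤ K)
    (hγ : 128 * B₃ * (A₁ * (4 * (p₁ : ℝ)) ^ p₁ * Real.sqrt γ) ≤ 1) : 128 * B₃ * deltaPrimeK A₁ p₁ F j ≤ 1 :=
  const_mul_deltaPrimeK_le (by positivity) hA₁ hp₁ hI hγ1 hj hγ

/-! ## §3. The radii `R_j` of [III] (2.5): `e^{−R_j} ≤ γ²` -/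

/-- **`e^{−R_j} ≤ γ²`**: by (2.5) `R_j ≥ (log g_j⁻²)^r ≥ (log γ⁻²)^r ≥ log γ⁻²` for `0 < g_j ≤ γ`, `r ≥ 1` and
`log γ⁻² ≥ 1` (i.e. `γ ≤ e^{−1/2}`), and `e^{−log γ⁻²} = γ²`. [cite: Balaban1988Convergent, (2.5) p.255] -/
theorem exp_neg_R_le_gamma_sq {L r : ℕ} (hr : 1 ≤ r) {g : ℝ} {R : ℕ} (h : B14.IsRj L r g R) (hg : 0 < g)
    (hgγ : g ≤ γ) (hγe : 1 ≤ Real.log (γ ^ 2)⁻¹) : Real.exp (-(R : ℝ)) ≤ γ ^ 2 := by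
  have hγ : 0 < γ := hg.trans_le hgγ
  have hγ1 : γ ≤ 1 := by
    by_contra hc
    have hc : 1 < γ := lt_of_not_ge hc
    have : Real.log (γ ^ 2)⁻¹ < 0 := by
      apply Real.log_neg (by positivity)
      rw [inv_lt_one₀ (by positivity)]
      nlinarith
    linarith
  have h1 := exp_neg_R_le_of_isRj h hg hgγ hγ1
  have h2 : Real.log (γ ^ 2)⁻¹ ≤ (Real.log (γ ^ 2)⁻¹) ^ r := le_self_pow₀ hγe (by omega)
  have h3 : Real.exp (-(Real.log (γ ^ 2)⁻¹) ^ r) ≤ Real.exp (-(Real.log (γ ^ 2)⁻¹)) :=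
    Real.exp_le_exp.mpr (by linarith)
  have h4 : Real.exp (-(Real.log (γ ^ 2)⁻¹)) = γ ^ 2 := by
    rw [Real.log_inv, neg_neg, Real.exp_log (by positivity)]
  linarith [h4.symm.le]

/-- `e^{−cR_j} ≤ γ²` for any rate `c ≥ 1` (the exponents `δ2M₂R_j`, `δLM₂R_{j+1}`, `δMR_{j+1}` of (1.31)/(1.42)/(1.38)
with `δ2M₂, δLM₂, δM ≥ 1`). [cite: Balaban1988Convergent, (2.5) p.255] -/
theorem exp_neg_mul_R_le_gamma_sq {L r : ℕ} (hr : 1 ≤ r) {g c : ℝ} {R : ℕ} (h : B14.IsRj L r g R) (hg : 0 < g)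
    (hgγ : g ≤ γ) (hγe : 1 ≤ Real.log (γ ^ 2)⁻¹) (hc : 1 ≤ c) : Real.exp (-(c * R)) ≤ γ ^ 2 := by
  have hR : (0 : ℝ) ≤ R := Nat.cast_nonneg R
  have h1 : Real.exp (-(c * R)) ≤ Real.exp (-(R : ℝ)) := Real.exp_le_exp.mpr (by nlinarith)
  exact h1.trans (exp_neg_R_le_gamma_sq hr h hg hgγ hγe)

/-! ## §4. The discharges -/

/-- **(1.31) input, p. 184**: *"B₃exp(−δ2M₂R_j)22d²ε_j < (β/10)ε_j"* from `δ2M₂ ≥ 1`, (2.5) for `R_j`, `0 < g_j ≤ γ`,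
`log γ⁻² ≥ 1`, `ε_j > 0`, `B₃ ≥ 0` and the explicit clause `B₃22d²γ² < β/10`. [cite: Balaban1989LargeFieldI, (1.31) p.184] -/
theorem ineq131_input_of_gamma {L r : ℕ} (hr : 1 ≤ r) {g B₃ δ M₂ d εj β : ℝ} {R : ℕ} (h : B14.IsRj L r g R)
    (hg : 0 < g) (hgγ : g ≤ γ) (hγe : 1 ≤ Real.log (γ ^ 2)⁻¹) (hc : 1 ≤ δ * 2 * M₂) (hB₃ : 0 ≤ B₃) (hε : 0 < εj)
    (hγ : B₃ * (22 * d ^ 2) * γ ^ 2 < β / 10) :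
    B₃ * Real.exp (-(δ * 2 * M₂ * R)) * (22 * d ^ 2) * εj < β / 10 * εj := by
  have h1 := exp_neg_mul_R_le_gamma_sq hr h hg hgγ hγe hc
  have h2 : B₃ * Real.exp (-(δ * 2 * M₂ * R)) * (22 * d ^ 2) ≤ B₃ * (22 * d ^ 2) * γ ^ 2 := by
    have := mul_le_mul_of_nonneg_left h1 (show 0 ≤ B₃ * (22 * d ^ 2) by positivity)
    calc B₃ * Real.exp (-(δ * 2 * M₂ * R)) * (22 * d ^ 2) = B₃ * (22 * d ^ 2) * Real.exp (-(δ * 2 * M₂ * R)) := by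
          ring
      _ ≤ B₃ * (22 * d ^ 2) * γ ^ 2 := this
  have h3 := mul_lt_mul_of_pos_right (h2.trans_lt hγ) hε
  linarith

/-- **(1.42), last member, p. 185**: *"O(1)B₃exp(−δLM₂R_{j+1})22d²(1+β₀)(A₀/A₁)δ_j ≦ ½δ_j"* from `δLM₂ ≥ 1`, (2.5) for
`R_{j+1}`, `0 < g_{j+1} ≤ γ`, `log γ⁻² ≥ 1`, signs, and the explicit clause `O(1)B₃22d²(1+β₀)(A₀/A₁)γ² ≤ ½`. [cite: Balaban1989LargeFieldI, (1.42) p.185] -/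
theorem ineq142_second_of_gamma {Lnat r : ℕ} (hr : 1 ≤ r) {g C B₃ δ L M₂ d β₀ A₀ A₁ δj : ℝ} {R : ℕ}
    (h : B14.IsRj Lnat r g R) (hg : 0 < g) (hgγ : g ≤ γ) (hγe : 1 ≤ Real.log (γ ^ 2)⁻¹) (hc : 1 ≤ δ * L * M₂)
    (hK : 0 ≤ C * B₃ * (22 * d ^ 2) * (1 + β₀) * (A₀ / A₁)) (hδj : 0 ≤ δj)
    (hγ : C * B₃ * (22 * d ^ 2) * (1 + β₀) * (A₀ / A₁) * γ ^ 2 ≤ 1 / 2) :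
    C * B₃ * Real.exp (-(δ * L * M₂ * R)) * (22 * d ^ 2) * (1 + β₀) * (A₀ / A₁) * δj ≤ δj / 2 := by
  have h1 := exp_neg_mul_R_le_gamma_sq hr h hg hgγ hγe hc
  have h2 : C * B₃ * Real.exp (-(δ * L * M₂ * R)) * (22 * d ^ 2) * (1 + β₀) * (A₀ / A₁)
      ≤ C * B₃ * (22 * d ^ 2) * (1 + β₀) * (A₀ / A₁) * γ ^ 2 := by
    have := mul_le_mul_of_nonneg_left h1 hK
    calc C * B₃ * Real.exp (-(δ * L * M₂ * R)) * (22 * d ^ 2) * (1 + β₀) * (A₀ / A₁)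
        = C * B₃ * (22 * d ^ 2) * (1 + β₀) * (A₀ / A₁) * Real.exp (-(δ * L * M₂ * R)) := by ring
      _ ≤ C * B₃ * (22 * d ^ 2) * (1 + β₀) * (A₀ / A₁) * γ ^ 2 := this
  have h3 := mul_le_mul_of_nonneg_right (h2.trans hγ) hδj
  linarith

/-- **(1.42) p. 185 as the typed leaf** `Ineq142`: its first member (the `ℍ^{(j)}_{□′}`-decay input) as hypothesis, its
last member from the γ-clause of `ineq142_second_of_gamma`. [cite: Balaban1989LargeFieldI, (1.42) p.185] -/
theorem ineq142_of_gamma {Lnat r : ℕ} (hr : 1 ≤ r) {diff' g C B₃ δ L M₂ d β₀ A₀ A₁ δj : ℝ} {R : ℕ}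
    (hfirst : diff' < C * B₃ * Real.exp (-(δ * L * M₂ * R)) * (22 * d ^ 2) * (1 + β₀) * (A₀ / A₁) * δj)
    (h : B14.IsRj Lnat r g R) (hg : 0 < g) (hgγ : g ≤ γ) (hγe : 1 ≤ Real.log (γ ^ 2)⁻¹) (hc : 1 ≤ δ * L * M₂)
    (hK : 0 ≤ C * B₃ * (22 * d ^ 2) * (1 + β₀) * (A₀ / A₁)) (hδj : 0 ≤ δj)
    (hγ : C * B₃ * (22 * d ^ 2) * (1 + β₀) * (A₀ / A₁) * γ ^ 2 ≤ 1 / 2) :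
    Ineq142 diff' C B₃ δ L M₂ R d β₀ A₀ A₁ δj :=
  ⟨hfirst, ineq142_second_of_gamma hr h hg hgγ hγe hc hK hδj hγ⟩

/-- **(1.90) p. 198, the α-clause**: *"11d²B₃exp(−R_h)ε_h < αε_h"* — `11d²B₃e^{−R_h} < α` from (2.5) for `R_h`,
`0 < g_h ≤ γ`, `log γ⁻² ≥ 1` and the explicit clause `11d²B₃γ² < α` (`B₃ ≥ 0`). [cite: Balaban1989LargeFieldI, (1.90) p.198] -/
theorem alpha_clause190_of_gamma {L r : ℕ} (hr : 1 ≤ r) {g B₃ d α : ℝ} {R : ℕ} (h : B14.IsRj L r g R) (hg : 0 < g)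
    (hgγ : g ≤ γ) (hγe : 1 ≤ Real.log (γ ^ 2)⁻¹) (hB₃ : 0 ≤ B₃) (hγ : 11 * d ^ 2 * B₃ * γ ^ 2 < α) :
    11 * d ^ 2 * B₃ * Real.exp (-(R : ℝ)) < α := by
  have h1 := exp_neg_R_le_gamma_sq hr h hg hgγ hγe
  have h2 := mul_le_mul_of_nonneg_left h1 (show 0 ≤ 11 * d ^ 2 * B₃ by positivity)
  exact h2.trans_lt hγ

/-- **(1.90) p. 198, the whole smallness chain with its α-clause discharged**: the typed first member `BoundH190 sH B₃ δ L
M₂ R_h d ε_h` gives `sH < αε_h` under `1 < δ2LM₂`, `R_h > 0`, `B₃, d, ε_h > 0` (`B15Ineq157Flow.boundH190_lt_alpha`) and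
the γ-clause `11d²B₃γ² < α`. [cite: Balaban1989LargeFieldI, (1.90) p.198] -/
theorem boundH190_lt_alpha_of_gamma {Lnat r : ℕ} (hr : 1 ≤ r) {sH g B₃ δ L M₂ d εh α : ℝ} {R : ℕ}
    (h190 : BoundH190 sH B₃ δ L M₂ R d εh) (h : B14.IsRj Lnat r g R) (hg : 0 < g) (hgγ : g ≤ γ)
    (hγe : 1 ≤ Real.log (γ ^ 2)⁻¹) (hc : 1 < δ * 2 * L * M₂) (hRh : 0 < (R : ℝ)) (hB₃ : 0 < B₃) (hd : 0 < d)
    (hε : 0 < εh) (hγ : 11 * d ^ 2 * B₃ * γ ^ 2 < α) : sH < α * εh :=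
  boundH190_lt_alpha h190 hc hRh hB₃ hd hε (alpha_clause190_of_gamma hr h hg hgγ hγe hB₃.le hγ)

/-- **p. 185, the ratio `p₁(g_j)/p₀(g_j)`**: for `p₁ < p₀`, `0 < g ≤ γ` and `log γ⁻² ≥ 1`,
`(log g⁻²)^{p₁}/(log g⁻²)^{p₀} ≤ (log γ⁻²)⁻¹`. [cite: Balaban1989LargeFieldI, (1.38) p.185] -/
theorem logPow_ratio_le {p₀ p₁ : ℕ} (hp : p₁ < p₀) {g : ℝ} (hg : 0 < g) (hgγ : g ≤ γ)
    (hγe : 1 ≤ Real.log (γ ^ 2)⁻¹) : logPow p₁ g / logPow p₀ g ≤ (Real.log (γ ^ 2)⁻¹)⁻¹ := by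
  have hmono : Real.log (γ ^ 2)⁻¹ ≤ Real.log (g ^ 2)⁻¹ := log_inv_sq_mono hg hgγ
  set x := Real.log (g ^ 2)⁻¹ with hx
  have hx1 : 1 ≤ x := hγe.trans hmono
  have hx0 : 0 < x := by linarith
  unfold logPow
  have e1 : x ^ p₁ / x ^ p₀ = (x ^ (p₀ - p₁))⁻¹ := by
    rw [inv_eq_one_div, div_eq_div_iff (pow_ne_zero _ hx0.ne') (pow_ne_zero _ hx0.ne'), one_mul, ← pow_add,
      Nat.add_sub_cancel' hp.le]
  rw [e1]
  have h2 : Real.log (γ ^ 2)⁻¹ ≤ x ^ (p₀ - p₁) :=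
    hmono.trans (le_self_pow₀ hx1 (by omega))
  exact inv_anti₀ (by linarith) h2

/-- **p. 185** *"We assume that it [γ] is so small that the expression on the left-hand side of (1.37) can be bounded by
½δ_j"*: with the (1.37) constant `c ≥ 0` and the (1.38) bracket `B₃(4p₁(g_j)/p₀(g_j) + exp(−δMR_{j+1})44d²(1+β₀)A₀/A₁)`
(`eq138_last`), the product is `≤ ½` as soon as `c·B₃(4(log γ⁻²)⁻¹ + 44d²(1+β₀)(A₀/A₁)γ²) ≤ ½` (`δM ≥ 1`, (2.5) for
`R_{j+1}`, `0 < g_j, g_{j+1} ≤ γ`, `log γ⁻² ≥ 1`, signs). [cite: Balaban1989LargeFieldI, (1.39) p.185] -/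
theorem ineq137_half_of_gamma {Lnat r : ℕ} (hr : 1 ≤ r) {p₀ p₁ : ℕ} (hp : p₁ < p₀) {gj gj1 c B₃ δ M d β₀ A₀ A₁ : ℝ}
    {R : ℕ} (hgj : 0 < gj) (hgjγ : gj ≤ γ) (h : B14.IsRj Lnat r gj1 R) (hgj1 : 0 < gj1) (hgj1γ : gj1 ≤ γ)
    (hγe : 1 ≤ Real.log (γ ^ 2)⁻¹) (hcM : 1 ≤ δ * M) (hc : 0 ≤ c) (hB₃ : 0 ≤ B₃) (hK : 0 ≤ 44 * d ^ 2 * (1 + β₀) * (A₀ / A₁))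
    (hγ : c * B₃ * (4 * (Real.log (γ ^ 2)⁻¹)⁻¹ + 44 * d ^ 2 * (1 + β₀) * (A₀ / A₁) * γ ^ 2) ≤ 1 / 2) :
    c * B₃ * (4 * (logPow p₁ gj / logPow p₀ gj) + Real.exp (-(δ * M * R)) * (44 * d ^ 2) * (1 + β₀) * (A₀ / A₁))
      ≤ 1 / 2 := by
  have h1 := logPow_ratio_le hp hgj hgjγ hγe
  have h2 := exp_neg_mul_R_le_gamma_sq hr h hgj1 hgj1γ hγe hcM
  have h3 : Real.exp (-(δ * M * R)) * (44 * d ^ 2) * (1 + β₀) * (A₀ / A₁)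
      ≤ 44 * d ^ 2 * (1 + β₀) * (A₀ / A₁) * γ ^ 2 := by
    have := mul_le_mul_of_nonneg_left h2 hK
    calc Real.exp (-(δ * M * R)) * (44 * d ^ 2) * (1 + β₀) * (A₀ / A₁)
        = 44 * d ^ 2 * (1 + β₀) * (A₀ / A₁) * Real.exp (-(δ * M * R)) := by ring
      _ ≤ 44 * d ^ 2 * (1 + β₀) * (A₀ / A₁) * γ ^ 2 := this
  have h4 : 4 * (logPow p₁ gj / logPow p₀ gj) + Real.exp (-(δ * M * R)) * (44 * d ^ 2) * (1 + β₀) * (A₀ / A₁)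
      ≤ 4 * (Real.log (γ ^ 2)⁻¹)⁻¹ + 44 * d ^ 2 * (1 + β₀) * (A₀ / A₁) * γ ^ 2 := by linarith
  exact (mul_le_mul_of_nonneg_left h4 (by positivity)).trans hγ

/-- **Note@184, p. 184** *"O(1)δ′_j < ε_j"*: the hypothesis `C·A₁ < A₀(log g_j⁻²)^{p₀−p₁}` of `B15Claim184.smallness184`
from `p₁ < p₀`, `0 < g_j ≤ γ`, `log γ⁻² ≥ 1`, `A₀ ≥ 0` and the explicit clause `C·A₁ < A₀·log γ⁻²`. [cite: Balaban1989LargeFieldI, p.184] -/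
theorem smallness184_hyp_of_gamma {p₀ p₁ : ℕ} (hp : p₁ < p₀) {g C A₀ A₁ : ℝ} (hg : 0 < g) (hgγ : g ≤ γ)
    (hγe : 1 ≤ Real.log (γ ^ 2)⁻¹) (hA₀ : 0 ≤ A₀) (hγ : C * A₁ < A₀ * Real.log (γ ^ 2)⁻¹) :
    C * A₁ < A₀ * logPow (p₀ - p₁) g := by
  have hmono : Real.log (γ ^ 2)⁻¹ ≤ Real.log (g ^ 2)⁻¹ := log_inv_sq_mono hg hgγ
  have h1 : Real.log (γ ^ 2)⁻¹ ≤ logPow (p₀ - p₁) g := by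
    unfold logPow
    exact hmono.trans (le_self_pow₀ (hγe.trans hmono) (by omega))
  exact hγ.trans_le (mul_le_mul_of_nonneg_left h1 hA₀)

/-- **Note@184 along the flow**: `C·δ′_j < ε_j` (`B15Claim184.smallness184`) for `j ≤ K` from `0 < g_k ≤ γ < 1`,
`p₁ < p₀`, `A₀ ≥ 0`, `log γ⁻² ≥ 1` and `C·A₁ < A₀·log γ⁻²`. [cite: Balaban1989LargeFieldI, p.184] -/
theorem smallness184_of_gamma {C A₀ A₁ : ℝ} {p₀ p₁ : ℕ} (hp : p₁ < p₀) (hI : F.InInterval γ K) (hγ1 : γ < 1)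
    (hγe : 1 ≤ Real.log (γ ^ 2)⁻¹) (hA₀ : 0 ≤ A₀) (hγ : C * A₁ < A₀ * Real.log (γ ^ 2)⁻¹) {j : ℕ} (hj : j ≤ K) :
    C * deltaPrimeK A₁ p₁ F j < epsK A₀ p₀ F j := by
  obtain ⟨hg, hgγ⟩ := hI j hj
  exact smallness184 hg (hgγ.trans_lt hγ1) hp.le (smallness184_hyp_of_gamma hp hg hgγ hγe hA₀ hγ)

end Flow

end Literature.MathematicalPhysics.QuantumFieldTheory.Balaban1983to89.B15GammaSmallness
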